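import Summits.NavierStokesRegularity.NavierStokesRegularity.Theses.QuantisedSymmetry
import Summits.NavierStokesRegularity.NavierStokesRegularity.Theses.Blowup
import Summits.NavierStokesRegularity.NavierStokesRegularity.Theorems.QuantisedSymmetryPolyhedralDssProfileExistsDominatesBlowupProfile
import Summits.NavierStokesRegularity.NavierStokesRegularity.Theorems.QuantisedSymmetryPolyhedralTruncationBridge

/-!
# Strategist sketch s16-g2 — typed census attempts for crux stmt-NavierStokesRegularity-1404
`QuantisedSymmetry.PolyhedralDssProfileExists` (X⁻).

Local scratch of the independent strategy census (family `s`, gen 2). Nothing here is a route item.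
It types: the weaker intermediate W1 read off the summit (= `Blowup.BlowupTypeIDssProfile`, stmt-0155) with
the tree implication X⁻ → W1; the best decomposition found (A1 `UniformApproximateProfiles`, A2
`ProfileCompactness`) with its assembly A1 → A2 → X⁻ PROVED and the sandwich X⁻ → A1 PROVED (so A1 is the
whole crux modulo the compactness lemma A2); the rigidifying strengthening S⁺₁ (continuous self-similarity)
with S⁺₁ → X⁻ PROVED (S⁺₁ is excluded in print: NRŠ 1996 / Tsai 1998, barrier
`LeraySelfSimilarBlowupExclusion`).
-/

set_option linter.dupNamespace false

namespace Summit.NavierStokesRegularity.NavierStokesRegularity.Cruxes.PolyhedralDssProfileExists.StrategistS16g2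

open MeasureTheory Literature.Analysis.FluidPDE
open _root_.Summit.NavierStokesRegularity.NavierStokesRegularity.Theses

/-- The three group clauses of X⁻ (finite, orientation-preserving, irreducible on `ℝ³`). -/
def IsPolyhedral (G : Subgroup (EuclideanSpace ℝ (Fin 3) ≃ₗᵢ[ℝ] EuclideanSpace ℝ (Fin 3))) : Prop :=
  Finite G ∧
    (∀ g ∈ G, LinearMap.det (g.toLinearEquiv :
        EuclideanSpace ℝ (Fin 3) →ₗ[ℝ] EuclideanSpace ℝ (Fin 3)) = 1) ∧
      ∀ V : Submodule ℝ (EuclideanSpace ℝ (Fin 3)), (∀ g ∈ G, ∀ v ∈ V, g v ∈ V) → V = ⊥ ∨ V = ⊤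

/-- Profile clauses of X⁻ for a FORCED ancient mild field (`f = 0` gives exactly X⁻'s clauses with a
named Type-I constant `C₀`). -/
def IsForcedPolyhedralProfile (G : Subgroup (EuclideanSpace ℝ (Fin 3) ≃ₗᵢ[ℝ] EuclideanSpace ℝ (Fin 3)))
    (c C₀ : ℝ) (f u : ℝ → EuclideanSpace ℝ (Fin 3) → EuclideanSpace ℝ (Fin 3)) : Prop :=
  (∀ t < 0, IsWeaklyDivFree (u t)) ∧
    (∀ s t : ℝ, s < t → t < 0 → IsMildNSSolutionBetween 1 f u s t) ∧
      (∀ t < 0, AEStronglyMeasurable (u t) volume) ∧ IsDiscretelySelfSimilar c u ∧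
        HasTypeIDecay C₀ u ∧ ∀ g ∈ G, ∀ t x, u t (g x) = g (u t x)

/-! ## Why the crux is (at least) summit-strength: X⁻ alone decides the sub-problem -/

/-- **X⁻ ⊢ ¬ NavierStokesRegularity by tree theorems** (the route's `closes` with its two other binders
discharged: the truncation bridge `quantisedSymmetry_polyhedralTruncationBridge_proof` — an instance of the
PROVED general (R)DSS truncation `filamentSkeletonRss_rdssProfileTruncation_proof`, which never uses `G` —
and `ClayUniqueness_holds`). No converse `¬ NavierStokesRegularity → X⁻` is known or expected. -/
theorem crux_decides_summit :
    QuantisedSymmetry.PolyhedralDssProfileExists → ¬ _root_.NavierStokesRegularity := fun hX =>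
  QuantisedSymmetry.closes hX
    _root_.Summit.NavierStokesRegularity.NavierStokesRegularity.Theorems.quantisedSymmetry_polyhedralTruncationBridge_proof
    QuantisedSymmetry.ClayUniqueness_holds

/-! ## Weaker intermediate (read off the summit statement) -/

/-- **W1.** The strictly weaker intermediate between X⁻ and `¬ NavierStokesRegularity` that the tree
already types is stmt-0155 `Blowup.BlowupTypeIDssProfile` (¬ Tsai's Type-I (R)DSS Liouville); X⁻ → W1 is
the landed `stub_dominatesBlowupProfile`. -/
theorem weakerIntermediate_of_crux :
    QuantisedSymmetry.PolyhedralDssProfileExists → Blowup.BlowupTypeIDssProfile :=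
  _root_.Summit.NavierStokesRegularity.NavierStokesRegularity.Theorems.PolyhedralDssProfileExists.PolyhedralCell.stub_dominatesBlowupProfile

/-! ## Decomposition A: near-profiles + compactness -/

/-- **A1 `UniformApproximateProfiles`.** There are a polyhedral `G`, a factor `c > 1`, ONE Type-I
constant `C₀`, an amplitude floor `η > 0` and a sequence of `G`-equivariant `c`-DSS Type-I(`C₀`) ancient
mild solutions `u_N` of Navier–Stokes WITH forces `f_N` whose scale-invariant envelope
`δ_N = sup (‖x‖+√-t)³‖f_N‖` tends to `0`, each of scale-invariant amplitude `≥ η` somewhere. -/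
def UniformApproximateProfiles : Prop :=
  ∃ G : Subgroup (EuclideanSpace ℝ (Fin 3) ≃ₗᵢ[ℝ] EuclideanSpace ℝ (Fin 3)), IsPolyhedral G ∧
    ∃ c : ℝ, 1 < c ∧ ∃ C₀ η : ℝ, 0 < η ∧
      ∃ (u f : ℕ → ℝ → EuclideanSpace ℝ (Fin 3) → EuclideanSpace ℝ (Fin 3)) (δ : ℕ → ℝ),
        Filter.Tendsto δ Filter.atTop (nhds 0) ∧
          ∀ N, IsForcedPolyhedralProfile G c C₀ (f N) (u N) ∧
            (∀ t < 0, ∀ x, ‖f N t x‖ ≤ δ N / (‖x‖ + Real.sqrt (-t)) ^ 3) ∧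
              ∃ t < 0, ∃ x, η ≤ (‖x‖ + Real.sqrt (-t)) * ‖u N t x‖

/-- **A2 `ProfileCompactness`.** Every family as in A1 has a nontrivial UNFORCED limit profile in the
same symmetry class with the same factor and Type-I constant (parabolic compactness of Type-I-bounded
near-solutions in similarity variables + non-escape of the amplitude point to spatial infinity). -/
def ProfileCompactness : Prop :=
  ∀ G : Subgroup (EuclideanSpace ℝ (Fin 3) ≃ₗᵢ[ℝ] EuclideanSpace ℝ (Fin 3)), IsPolyhedral G →
    ∀ c : ℝ, 1 < c → ∀ C₀ η : ℝ, 0 < η →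
      ∀ (u f : ℕ → ℝ → EuclideanSpace ℝ (Fin 3) → EuclideanSpace ℝ (Fin 3)) (δ : ℕ → ℝ),
        Filter.Tendsto δ Filter.atTop (nhds 0) →
          (∀ N, IsForcedPolyhedralProfile G c C₀ (f N) (u N) ∧
            (∀ t < 0, ∀ x, ‖f N t x‖ ≤ δ N / (‖x‖ + Real.sqrt (-t)) ^ 3) ∧
              ∃ t < 0, ∃ x, η ≤ (‖x‖ + Real.sqrt (-t)) * ‖u N t x‖) →
            ∃ v : ℝ → EuclideanSpace ℝ (Fin 3) → EuclideanSpace ℝ (Fin 3),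
              IsForcedPolyhedralProfile G c C₀ 0 v ∧ ¬ (∀ t < 0, v t =ᵐ[volume] 0)

/-- **Assembly of split A (proved):** A1 → A2 → X⁻. -/
theorem crux_of_splitA :
    UniformApproximateProfiles → ProfileCompactness → QuantisedSymmetry.PolyhedralDssProfileExists := by
  rintro ⟨G, hG, c, hc, C₀, η, hη, u, f, δ, hδ, hN⟩ hA2
  obtain ⟨v, ⟨hdiv, hmild, hmeas, hdss, hdec, heq⟩, hnt⟩ := hA2 G hG c hc C₀ η hη u f δ hδ hN
  exact ⟨G, hG.1, hG.2.1, hG.2.2, c, hc, v, ⟨hdiv, hmild⟩, hmeas, hdss, ⟨C₀, hdec⟩, heq, hnt⟩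

/-- **Sandwich (proved): X⁻ → A1** (constant sequence, zero force, `η` = the scale-invariant amplitude at a
point where the profile is nonzero). Hence, given the compactness lemma A2, A1 ↔ X⁻: A1 is the whole crux. -/
theorem splitA_of_crux :
    QuantisedSymmetry.PolyhedralDssProfileExists → UniformApproximateProfiles := by
  rintro ⟨G, hfin, hdet, hirr, c, hc, u, ⟨hdiv, hmild⟩, hmeas, hdss, ⟨C₀, hdec⟩, heq, hnt⟩
  have hpt : ∃ t, t < 0 ∧ ∃ x, u t x ≠ 0 := by
    by_contra h
    push Not at h
    exact hnt fun t ht => Filter.Eventually.of_forall fun x => h t ht x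
  obtain ⟨t₀, ht₀, x₀, hx₀⟩ := hpt
  have hpos : 0 < (‖x₀‖ + Real.sqrt (-t₀)) * ‖u t₀ x₀‖ := by
    have h1 : 0 < Real.sqrt (-t₀) := Real.sqrt_pos.2 (by linarith)
    have h2 : 0 < ‖x₀‖ + Real.sqrt (-t₀) := by positivity
    exact mul_pos h2 (norm_pos_iff.2 hx₀)
  refine ⟨G, ⟨hfin, hdet, hirr⟩, c, hc, C₀, (‖x₀‖ + Real.sqrt (-t₀)) * ‖u t₀ x₀‖, hpos,
    fun _ => u, fun _ => 0, fun _ => 0, tendsto_const_nhds, fun N => ⟨?_, ?_, ?_⟩⟩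
  · exact ⟨hdiv, hmild, hmeas, hdss, hdec, heq⟩
  · intro t ht x
    simp
  · exact ⟨t₀, ht₀, x₀, le_rfl⟩

/-! ## Strengthening S⁺₁: continuous self-similarity (refuted in print) -/

/-- **S⁺₁ `PolyhedralSelfSimilarProfileExists`.** X⁻ with `IsSelfSimilar u` (every factor) in place of
one factor `c`: the classical rigidification that turns the time-periodic Leray system into the STATIONARY
Leray profile system (elliptic, degree theory available) — and is excluded by Nečas–Růžička–Šverák 1996 /
Tsai 1998 (Type-I decay puts the profile in `L^q`, `q > 3`). -/
def PolyhedralSelfSimilarProfileExists : Prop :=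
  ∃ G : Subgroup (EuclideanSpace ℝ (Fin 3) ≃ₗᵢ[ℝ] EuclideanSpace ℝ (Fin 3)), IsPolyhedral G ∧
    ∃ u : ℝ → EuclideanSpace ℝ (Fin 3) → EuclideanSpace ℝ (Fin 3),
      IsAncientMildSolution 1 u ∧ (∀ t < 0, AEStronglyMeasurable (u t) volume) ∧ IsSelfSimilar u ∧
        (∃ C₀ : ℝ, HasTypeIDecay C₀ u) ∧ (∀ g ∈ G, ∀ t x, u t (g x) = g (u t x)) ∧
          ¬ (∀ t < 0, u t =ᵐ[volume] 0)

/-- **S⁺₁ → X⁻ (proved)**, with factor `2`. -/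
theorem crux_of_selfSimilar :
    PolyhedralSelfSimilarProfileExists → QuantisedSymmetry.PolyhedralDssProfileExists := by
  rintro ⟨G, ⟨hfin, hdet, hirr⟩, u, hanc, hmeas, hss, hdec, heq, hnt⟩
  exact ⟨G, hfin, hdet, hirr, 2, by norm_num, u, hanc, hmeas,
    hss.isDiscretelySelfSimilar (by norm_num), hdec, heq, hnt⟩

/-! ## Negation side: the kill switch is the route's own item -/

/-- The negation of X⁻ in the route is reached through `PolyhedralTypeILiouville` (stmt-1405) via the
proved `LiouvilleKillsProfile`; recorded here only to fix names. -/
example : QuantisedSymmetry.LiouvilleKillsProfile =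
    (QuantisedSymmetry.PolyhedralTypeILiouville → ¬ QuantisedSymmetry.PolyhedralDssProfileExists) := by
  rfl

end Summit.NavierStokesRegularity.NavierStokesRegularity.Cruxes.PolyhedralDssProfileExists.StrategistS16g2
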